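import Mathlib
import Literature.Analysis.FluidPDE.ClassicalSolution
import Literature.Analysis.FluidPDE.VectorCalculus
import HarnessLib

/-!
# Route SlicedKelvin — posited objects of the fold-law line of the crux `PlanarFluxAPriori`

Definitions (plus one definitional unfolding lemma) naming the objects that the checked skeleton of the crux
`SlicedKelvin.PlanarFluxAPriori` (item `stmt-NavierStokesRegularity-15600`, line `registered`,
tree `Cruxes/PlanarFluxAPriori/Lines/birth.lean`) and its landed helper files
(`Theorems/SlicedKelvinPlanarFluxAPriori*.lean`) spell out inline. They exist so that the
reshaped stubs of the skeleton have SHORT, registrable signatures; every body below is the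
verbatim sub-term of the registered stub `stub_heatKernelDomination` / of the hypothesis of the
landed glue `Theorems.SlicedKelvinPlanarFluxAPriori.stub_heatKernelDomination_of_foldLawSubsolution`
that it abbreviates, so that those statements are DEFINITIONALLY equal to their abbreviated
forms (only `δ`/`β`-unfolding of the constants below is needed).

Setting (route header, card `planar-fold-law-unsigned-flux`): a frame `R` (linear isometry of
`ℝ³`), unit normal `n = R e₂`, the plane family `R{x₂ = c}` charted by
`y ↦ R (y₀, y₁, c)`, `y ∈ ℝ²`; for a velocity field `v`, `ω = curl v`, `f = ⟪ω, n⟫`, and the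
regularisation `F_ε(s) = √(s² + ε²)` of `|s|` (`F_ε' = s/F_ε`, `F_ε'' = ε²/F_ε³`).

* `foldDensity v R ε x` — the ε-regularised FOLD-CREATION DENSITY
  `s_ε = −⟪v,n⟫ · (ε²/F_ε(f)³) · (⟪ω,Re₀⟫·Df[Re₀] + ⟪ω,Re₁⟫·Df[Re₁]) − ε² · D⟪v,n⟫[n] / F_ε(f)`
  (the last two terms of the ε-fold law `FoldLawEps`, written frame-covariantly).
* `fluxProfile u R ε τ c` — the regularised planar flux profile
  `φ_ε(τ,c) = ∫_{R{x₂=c}} (F_ε(f) − ε)`, `f = ⟪curl (u τ), n⟫` (Bochner integral over `ℝ²`).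
* `foldSource u R ε τ c` — the plane integral of the positive part of the fold density,
  `S_ε(τ,c) = ∫_{R{x₂=c}} (s_ε(u τ; R))⁺`.
* `FoldLawSubsolution ν T u` — the ε-FOLD-LAW SUBSOLUTION PACKAGE of a velocity `u` on `[0,T)`:
  for every `t ∈ (0,T)`, `ε ∈ (0,1)` and frame `R`, `φ_ε` is a bounded classical subsolution of
  `∂_τ − ν∂_c²` on `[0,t] × ℝ` with source `S_ε` (joint continuity, first `τ`- and first and
  second `c`-derivatives with uniform bounds, the differential inequality), and the regularised
  density is integrable on every plane at time `t`. Verbatim the hypothesis of the landed glue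
  `stub_heatKernelDomination_of_foldLawSubsolution` (with `φ`, `S` abbreviated by `fluxProfile`,
  `foldSource`), which turns it into the registered stub `stub_heatKernelDomination`.
* `EpsFoldLawOn ν ε c R v` — the frame-covariant ε-FOLD LAW IDENTITY at a fixed time for a field
  `v` (the stub proves it for smooth divergence-free `v` with cubic spatial decay of its first
  three derivatives): on the plane `R{x₂ = c}`, `∫ F_ε'(f)·⟪w,n⟫ = ν∫ ∂_n²(F_ε∘f) − ν∫ F_ε''(f)|∇f|² − ∫ ⟪v,n⟫F_ε''(f)(ω_∥·∇_∥f)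
  − ε²∫ ∂_n⟪v,n⟫/F_ε(f)`, where `w = νΔω − (v·∇)ω + (ω·∇)v` is the vorticity tendency (the
  right-hand side of the vorticity equation `Literature.Analysis.FluidPDE.IsVorticitySolutionOn`).
  Transport and stretching have cancelled on the plane (in-plane integration by parts with
  `div v = 0`, `div ω = 0` and `f F_ε'(f) − F_ε(f) = −ε²/F_ε(f)`). It is the route's support
  item `FoldLawEps` (stmt-NavierStokesRegularity-15606) for a general frame and under the
  polynomial (not rapid) decay that a Navier–Stokes velocity actually has at positive times.

Sources: the route file `Theses/SlicedKelvin.lean` (items `PlanarFluxAPriori`, `FoldLawEps`);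
Welsch, ApJ 638 (2006) doi:10.1086/498638 and Démoulin–Berger, Sol. Phys. 215 (2003)
doi:10.1023/a:1025679813955 (the polarity-inversion-line flux budget, kinematic MHD form of the
fold law); Constantin, Comm. Math. Phys. 129 (1990) doi:10.1007/bf02096982 (vorticity budgets);
Majda–Bertozzi, *Vorticity and Incompressible Flow* (CUP 2002), §1.4–1.5 (vorticity equation).

Deliberately NOT here: any theorem beyond the unfolding lemma `fluxProfile_eq` (the identities and
the package are proved in the stub files of the line); the unsigned planar flux itself and the Duhamel fold-creation functional stay
inline in the route items, exactly as registered.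
-/

noncomputable section

-- Problem = summit for this single-conjunct summit: the duplicate namespace component is deliberate.
set_option linter.dupNamespace false

namespace Summit.NavierStokesRegularity.NavierStokesRegularity.Theorems.SlicedKelvin

open MeasureTheory

/-- The **ε-regularised fold-creation density** `s_ε(v; R)(x)` of a velocity field `v` in the
frame `R` (normal `n = R e₂`, `ω = curl v`, `f = ⟪ω, n⟫`, `F_ε(f) = √(f² + ε²)`):
`s_ε = −⟪v,n⟫ · (ε²/F_ε(f)³) · (⟪ω,Re₀⟫·Df[Re₀] + ⟪ω,Re₁⟫·Df[Re₁]) − ε² · D⟪v,n⟫[n] / F_ε(f)`.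
Verbatim the integrand of the Duhamel fold-creation functional in the route item
`SlicedKelvin.PlanarFluxAPriori`'s registered stubs (with `v` for the time slice `u τ`); junk
value inherited from `fderiv` where `v` is not differentiable. Source: route SlicedKelvin, support
item `FoldLawEps` (last two terms), after Welsch 2006 / Démoulin–Berger 2003 (PIL flux budget).
[folklore] -/
def foldDensity (v : EuclideanSpace ℝ (Fin 3) → EuclideanSpace ℝ (Fin 3))
    (R : EuclideanSpace ℝ (Fin 3) ≃ₗᵢ[ℝ] EuclideanSpace ℝ (Fin 3)) (ε : ℝ)
    (x : EuclideanSpace ℝ (Fin 3)) : ℝ :=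
  -(inner ℝ (v x) (R (EuclideanSpace.single 2 1))) * (ε ^ 2 / Real.sqrt (inner ℝ (Literature.Analysis.FluidPDE.curl v x) (R (EuclideanSpace.single 2 1)) ^ 2 + ε ^ 2) ^ 3) * (inner ℝ (Literature.Analysis.FluidPDE.curl v x) (R (EuclideanSpace.single 0 1)) * fderiv ℝ (fun z => inner ℝ (Literature.Analysis.FluidPDE.curl v z) (R (EuclideanSpace.single 2 1))) x (R (EuclideanSpace.single 0 1)) + inner ℝ (Literature.Analysis.FluidPDE.curl v x) (R (EuclideanSpace.single 1 1)) * fderiv ℝ (fun z => inner ℝ (Literature.Analysis.FluidPDE.curl v z) (R (EuclideanSpace.single 2 1))) x (R (EuclideanSpace.single 1 1))) - ε ^ 2 * fderiv ℝ (fun z => inner ℝ (v z) (R (EuclideanSpace.single 2 1))) x (R (EuclideanSpace.single 2 1)) / Real.sqrt (inner ℝ (Literature.Analysis.FluidPDE.curl v x) (R (EuclideanSpace.single 2 1)) ^ 2 + ε ^ 2)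

/-- The **regularised planar flux profile** `φ_ε(τ, c) = ∫_{R{x₂ = c}} (F_ε(f) − ε) dA` of a
time-dependent velocity `u` in the frame `R`, `f = ⟪curl (u τ), R e₂⟫`, `F_ε(f) = √(f² + ε²)`,
as a Bochner integral over the chart `y ↦ R (y₀, y₁, c)` of the plane (`F_ε(f) − ε ↑ |f|` as
`ε ↓ 0`, so `φ_ε ↑` the unsigned planar vorticity flux of the route item `PlanarFluxAPriori`).
Verbatim the `φ`-clause of the landed glue
`Theorems.SlicedKelvinPlanarFluxAPriori.stub_heatKernelDomination_of_foldLawSubsolution`.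
Source: route SlicedKelvin (rationale, "ENGINE"). [folklore] -/
def fluxProfile (u : ℝ → EuclideanSpace ℝ (Fin 3) → EuclideanSpace ℝ (Fin 3))
    (R : EuclideanSpace ℝ (Fin 3) ≃ₗᵢ[ℝ] EuclideanSpace ℝ (Fin 3)) (ε τ c : ℝ) : ℝ :=
  ∫ y : EuclideanSpace ℝ (Fin 2), (Real.sqrt (inner ℝ (Literature.Analysis.FluidPDE.curl (u τ) (R (WithLp.toLp 2 ![y 0, y 1, c]))) (R (EuclideanSpace.single 2 1)) ^ 2 + ε ^ 2) - ε)

/-- Unfolding lemma for `fluxProfile` (definitional; registered sub-goal `fluxProfile_eq` of the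
crux item, so that files of the line can rewrite with it). [folklore] -/
theorem fluxProfile_eq : ∀ (u : ℝ → EuclideanSpace ℝ (Fin 3) → EuclideanSpace ℝ (Fin 3)) (R : EuclideanSpace ℝ (Fin 3) ≃ₗᵢ[ℝ] EuclideanSpace ℝ (Fin 3)) (ε τ c : ℝ), Summit.NavierStokesRegularity.NavierStokesRegularity.Theorems.SlicedKelvin.fluxProfile u R ε τ c = ∫ y : EuclideanSpace ℝ (Fin 2), (Real.sqrt (inner ℝ (Literature.Analysis.FluidPDE.curl (u τ) (R (WithLp.toLp 2 ![y 0, y 1, c]))) (R (EuclideanSpace.single 2 1)) ^ 2 + ε ^ 2) - ε) :=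
  fun _ _ _ _ _ => rfl

/-- The **fold source** `S_ε(τ, c) = ∫_{R{x₂ = c}} (s_ε(u τ; R))⁺ dA`: the plane integral
(Bochner, over the chart `y ↦ R (y₀, y₁, c)`) of the positive part of the ε-regularised
fold-creation density `foldDensity`. Verbatim the `S`-clause of the landed glue
`Theorems.SlicedKelvinPlanarFluxAPriori.stub_heatKernelDomination_of_foldLawSubsolution`
(with the density abbreviated by `foldDensity`). Source: route SlicedKelvin (rationale). [folklore] -/
def foldSource (u : ℝ → EuclideanSpace ℝ (Fin 3) → EuclideanSpace ℝ (Fin 3))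
    (R : EuclideanSpace ℝ (Fin 3) ≃ₗᵢ[ℝ] EuclideanSpace ℝ (Fin 3)) (ε τ c : ℝ) : ℝ :=
  ∫ y : EuclideanSpace ℝ (Fin 2), max (foldDensity (u τ) R ε (R (WithLp.toLp 2 ![y 0, y 1, c]))) 0

/-- The **ε-fold-law subsolution package** of a velocity `u` with viscosity `ν` on `[0, T)`:
for every `t ∈ (0,T)`, `ε ∈ (0,1)` and frame `R` there are functions `φ S φₜ φ₁ φ₂ : ℝ → ℝ → ℝ`
and a bound `B` such that `φ = fluxProfile u R ε`, `S = foldSource u R ε`, `φ` is jointly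
continuous on `[0,t] × ℝ`, `φₜ` and `φ₂` jointly continuous on `(0,t) × ℝ`, `φₜ = ∂_τ φ`,
`φ₁ = ∂_c φ`, `φ₂ = ∂_c φ₁` on `(0,t) × ℝ`, `|φ| ≤ B` on `[0,t] × ℝ` and `|φₜ|, |φ₁|, |φ₂| ≤ B` on
`(0,t) × ℝ`, the SUBSOLUTION INEQUALITY `φₜ − ν φ₂ ≤ S` on `(0,t) × ℝ` (the ε-fold law with the
non-positive annihilation term dropped and the fold density replaced by its positive part), and
the regularised density `F_ε(f) − ε` is integrable on every plane at time `t`. This is, clause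
by clause, the hypothesis of the landed glue
`Theorems.SlicedKelvinPlanarFluxAPriori.stub_heatKernelDomination_of_foldLawSubsolution`
(specialised to one solution `u`), which converts it into the registered stub
`stub_heatKernelDomination` of the crux skeleton. Source: route SlicedKelvin (two-layer plan,
`HeatKernelFluxBound`). [folklore] -/
def FoldLawSubsolution (ν T : ℝ)
    (u : ℝ → EuclideanSpace ℝ (Fin 3) → EuclideanSpace ℝ (Fin 3)) : Prop :=
  ∀ t ∈ Set.Ioo 0 T, ∀ ε ∈ Set.Ioo (0 : ℝ) 1,
    ∀ (R : EuclideanSpace ℝ (Fin 3) ≃ₗᵢ[ℝ] EuclideanSpace ℝ (Fin 3)),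
      ∃ (φ S φₜ φ₁ φ₂ : ℝ → ℝ → ℝ) (B : ℝ),
        (∀ τ c, φ τ c = fluxProfile u R ε τ c) ∧
        (∀ τ c, S τ c = foldSource u R ε τ c) ∧
        ContinuousOn (Function.uncurry φ) (Set.Icc 0 t ×ˢ Set.univ) ∧
        ContinuousOn (Function.uncurry φₜ) (Set.Ioo 0 t ×ˢ Set.univ) ∧
        ContinuousOn (Function.uncurry φ₂) (Set.Ioo 0 t ×ˢ Set.univ) ∧
        (∀ τ ∈ Set.Ioo 0 t, ∀ c, HasDerivAt (fun σ => φ σ c) (φₜ τ c) τ) ∧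
        (∀ τ ∈ Set.Ioo 0 t, ∀ c, HasDerivAt (φ τ) (φ₁ τ c) c) ∧
        (∀ τ ∈ Set.Ioo 0 t, ∀ c, HasDerivAt (φ₁ τ) (φ₂ τ c) c) ∧
        (∀ τ ∈ Set.Icc 0 t, ∀ c, |φ τ c| ≤ B) ∧
        (∀ τ ∈ Set.Ioo 0 t, ∀ c, |φₜ τ c| ≤ B) ∧
        (∀ τ ∈ Set.Ioo 0 t, ∀ c, |φ₁ τ c| ≤ B) ∧
        (∀ τ ∈ Set.Ioo 0 t, ∀ c, |φ₂ τ c| ≤ B) ∧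
        (∀ τ ∈ Set.Ioo 0 t, ∀ c, φₜ τ c - ν * φ₂ τ c ≤ S τ c) ∧
        (∀ c, MeasureTheory.Integrable (fun y : EuclideanSpace ℝ (Fin 2) =>
          Real.sqrt (inner ℝ (Literature.Analysis.FluidPDE.curl (u t) (R (WithLp.toLp 2 ![y 0, y 1, c]))) (R (EuclideanSpace.single 2 1)) ^ 2 + ε ^ 2) - ε))

/-- The **frame-covariant ε-fold law identity at a fixed time** (the route's support item
`FoldLawEps`, stmt-NavierStokesRegularity-15606, for a general frame `R`; the line's stub proves it
for smooth divergence-free `v` whose derivatives of orders `≤ 3` decay like `(1 + ‖x‖)⁻³`, the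
decay a Navier–Stokes velocity actually has at positive times). For real `ν`, `ε`, a height `c`,
a frame `R` (normal `n = R e₂`, in-plane directions `Re₀, Re₁`) and a field `v` on `ℝ³`: with
`ω = curl v`, `f = ⟪ω, n⟫`, the vorticity tendency `w = νΔω − (v·∇)ω + (ω·∇)v` (right-hand side
of the vorticity equation, `Literature.Analysis.FluidPDE.IsVorticitySolutionOn`),
`F(s) = √(s² + ε²)` and `D g e x = fderiv ℝ g x e`, on the plane `P y = R (y₀, y₁, c)`:
`∫ F'(f) ⟪w, n⟫ = ν ∫ D(D(F∘f) n) n − ν ∫ (ε²/F(f)³)(Σ_{e ∈ {Re₀,Re₁,n}} (D f e)²)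
 − ∫ ⟪v,n⟫ (ε²/F(f)³)(⟪ω,Re₀⟫ D f Re₀ + ⟪ω,Re₁⟫ D f Re₁) − ε² ∫ D⟪v,n⟫ n / F(f)`
(all plane integrals Bochner over `ℝ²`). Transport and vortex stretching cancel: in-plane
integration by parts with `div v = 0`, `div ω = 0` and `f F'(f) − F(f) = −ε²/F(f)`. Sources: route
SlicedKelvin, item `FoldLawEps` (coordinate frame, rapid decay); Welsch 2006 doi:10.1086/498638,
Démoulin–Berger 2003 doi:10.1023/a:1025679813955 (kinematic MHD form); Majda–Bertozzi 2002 §1.5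
(vorticity equation). [folklore] -/
def EpsFoldLawOn (ν ε c : ℝ) (R : EuclideanSpace ℝ (Fin 3) ≃ₗᵢ[ℝ] EuclideanSpace ℝ (Fin 3))
    (v : EuclideanSpace ℝ (Fin 3) → EuclideanSpace ℝ (Fin 3)) : Prop :=
  let n : EuclideanSpace ℝ (Fin 3) := R (EuclideanSpace.single 2 1)
  let e₀ : EuclideanSpace ℝ (Fin 3) := R (EuclideanSpace.single 0 1)
  let e₁ : EuclideanSpace ℝ (Fin 3) := R (EuclideanSpace.single 1 1)
  let ω : EuclideanSpace ℝ (Fin 3) → EuclideanSpace ℝ (Fin 3) :=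
    Literature.Analysis.FluidPDE.curl v
  let f : EuclideanSpace ℝ (Fin 3) → ℝ := fun x => inner ℝ (ω x) n
  let w : EuclideanSpace ℝ (Fin 3) → EuclideanSpace ℝ (Fin 3) := fun x =>
    ν • Laplacian.laplacian ω x - Literature.Analysis.FluidPDE.convect v ω x +
      Literature.Analysis.FluidPDE.convect ω v x
  let F : ℝ → ℝ := fun s => Real.sqrt (s ^ 2 + ε ^ 2)
  let D : (EuclideanSpace ℝ (Fin 3) → ℝ) → EuclideanSpace ℝ (Fin 3) →
      EuclideanSpace ℝ (Fin 3) → ℝ := fun g e x => fderiv ℝ g x e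
  let P : EuclideanSpace ℝ (Fin 2) → EuclideanSpace ℝ (Fin 3) := fun y =>
    R (WithLp.toLp 2 ![y 0, y 1, c])
  (∫ y, (f (P y) / F (f (P y))) * inner ℝ (w (P y)) n) =
    ν * (∫ y, D (D (fun x => F (f x)) n) n (P y)) -
      ν * (∫ y, (ε ^ 2 / F (f (P y)) ^ 3) *
        (D f e₀ (P y) ^ 2 + D f e₁ (P y) ^ 2 + D f n (P y) ^ 2)) -
      (∫ y, inner ℝ (v (P y)) n * (ε ^ 2 / F (f (P y)) ^ 3) *
        (inner ℝ (ω (P y)) e₀ * D f e₀ (P y) + inner ℝ (ω (P y)) e₁ * D f e₁ (P y))) -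
      ε ^ 2 * (∫ y, D (fun x => inner ℝ (v x) n) n (P y) / F (f (P y)))

end Summit.NavierStokesRegularity.NavierStokesRegularity.Theorems.SlicedKelvin

end
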